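import Mathlib
import Summits.KontsevichZagierPeriods.KontsevichZagierPeriods.Theorems.InverseLandauTateFamilyKernelRationalCertificate
import Summits.KontsevichZagierPeriods.KontsevichZagierPeriods.Theorems.InverseLandauTateFamilyKernelGapInstance

/-!
# `TateFamilyKernel` — the fibrewise-loop family is certified with ONE auxiliary variable (line `Sketch`, stub `stub_loopInstance`)

Crux `TateFamilyKernel` (stmt-KontsevichZagierPeriods-9130, route `InverseLandau`), line `Sketch`.
The dimension-2 admissible Tate family `F = P/Q` with
`Q₁ = 1 − ϖ(z₁ + z₂²)`, `A = z₁(1 − z₁)`, `g = (z₁ + A·z₂/2, z₂)` (a polynomial self-map of the square),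
`Q = Q₁·(Q₁ ∘ g)`, `P = A′·Q₁ − A·∂₁Q₁ = (1 − 2z₁)Q₁ + ϖA`, is the `s`-average
`F = ∫₀¹ ∂_{z₁}(A/D_s) ds` along the LINEAR interpolation `D_s = Q₁ − s·(ϖz₂/2)·A = (1 − s)Q₁ + s·(Q₁ ∘ g)`
of the two denominators (`∫₀¹ ds/D_s² = 1/(Q₁·(Q₁ ∘ g))`), so its open-square integrals vanish
identically (`A` vanishes on the `z₁`-faces) although `F` is not a single `relA` move in the square
variables. Its tame fibres at every real-algebraic `ϖ₀` with `0 < ϖ₀ < 1/2` are nevertheless KZ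
relations by an `m = 1` rational Ayoub certificate on the cube `(w₀, w₁, s) ∈ [0,1]³`:
with `K = A/D_s` (direction `w₀`) and `M = −s(ϖA + A′Q₁)/(Q₁·D_s)` (direction `s`) one has
`∂₀K + ∂_sM = 0`, `K` vanishes on the faces `w₀ ∈ {0,1}`, `M|_{s=0} = 0` and `−M|_{s=1} = P/Q`, so
`F = relA₀(K) + relA_s(M)` pointwise on `[0,1]³`. This is `rational_certificate` (p111536) with
`n = 2`, `m = 1`, `K = 2`, directions `(0, 2)` and the (denominator-doubled) rational data
`A₀/D₀ = 2w₀(1−w₀) / (2Q₁ − s·ϖ·w₁·w₀(1−w₀)) = K`,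
`A₁/D₁ = −2s(ϖw₀(1−w₀) + (1−2w₀)Q₁) / (Q₁·(2Q₁ − s·ϖ·w₁·w₀(1−w₀))) = M`;
both denominators are `≥ (1 − 2ϖ₀)·min(1, 2(1 − 2ϖ₀)) > 0` on the closed cube (`2Q₁ ≥ 2(1 − 2ϖ₀)`,
`D₀ ≥ 2 − 4ϖ₀`), so there is no wall on `(0, 1/2)`.
References: Kontsevich–Zagier 2001 §1.2 rule (3); Ayoub, EMS Newsl. 91 (2014) Def. 10.
-/

noncomputable section

open MeasureTheory Set MvPolynomial
open Literature.NumberTheory.Transcendental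
open Literature.ModelTheory.ExponentialFields (IsSemialgebraic)

namespace Summit.KontsevichZagierPeriods.InverseLandau.TateFamilyKernel.Descent

namespace Loop

/-! ### Evaluation of the certificate polynomials (variables `X 0 = w₀, X 1 = w₁, X 2 = s, X 3 = ϖ`) -/

/-- Value of the numerator `A₀ = 2w₀(1−w₀)` (`= 2A`). [folklore] -/
theorem evalA0 (v : Fin (2 + 1 + 1) → ℝ) :
    aeval v ((C 2 * X 0 * (1 - X 0)) : MvPolynomial (Fin (2 + 1 + 1)) ℚ) = 2 * v 0 * (1 - v 0) := by
  simp

/-- Value of the numerator `A₁ = −2s(ϖw₀(1−w₀) + (1−2w₀)Q₁)` (`= −2s(ϖA + A′Q₁)`). [folklore] -/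
theorem evalA1 (v : Fin (2 + 1 + 1) → ℝ) :
    aeval v ((-(C 2 * X 2 * (X 3 * X 0 * (1 - X 0) + (1 - C 2 * X 0) * (1 - X 3 * (X 0 + X 1 ^ 2))))) :
        MvPolynomial (Fin (2 + 1 + 1)) ℚ) =
      -(2 * v 2 * (v 3 * v 0 * (1 - v 0) + (1 - 2 * v 0) * (1 - v 3 * (v 0 + v 1 ^ 2)))) := by
  simp

/-- Value of the denominator `D₀ = 2Q₁ − s·ϖ·w₁·w₀(1−w₀)` (`= 2D_s`). [folklore] -/
theorem evalD0 (v : Fin (2 + 1 + 1) → ℝ) :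
    aeval v ((C 2 * (1 - X 3 * (X 0 + X 1 ^ 2)) - X 2 * X 3 * X 1 * X 0 * (1 - X 0)) :
        MvPolynomial (Fin (2 + 1 + 1)) ℚ) =
      2 * (1 - v 3 * (v 0 + v 1 ^ 2)) - v 2 * v 3 * v 1 * v 0 * (1 - v 0) := by
  simp

/-- Value of the denominator `D₁ = Q₁·D₀`. [folklore] -/
theorem evalD1 (v : Fin (2 + 1 + 1) → ℝ) :
    aeval v (((1 - X 3 * (X 0 + X 1 ^ 2)) * (C 2 * (1 - X 3 * (X 0 + X 1 ^ 2)) - X 2 * X 3 * X 1 * X 0 * (1 - X 0))) :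
        MvPolynomial (Fin (2 + 1 + 1)) ℚ) =
      (1 - v 3 * (v 0 + v 1 ^ 2)) * (2 * (1 - v 3 * (v 0 + v 1 ^ 2)) - v 2 * v 3 * v 1 * v 0 * (1 - v 0)) := by
  simp

/-- Value of the derivative numerator `∂₀A₀·D₀ − A₀·∂₀D₀`. [folklore] -/
theorem evalN0 (v : Fin (2 + 1 + 1) → ℝ) :
    aeval v (pderiv 0 ((C 2 * X 0 * (1 - X 0)) : MvPolynomial (Fin (2 + 1 + 1)) ℚ) *
          (C 2 * (1 - X 3 * (X 0 + X 1 ^ 2)) - X 2 * X 3 * X 1 * X 0 * (1 - X 0)) -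
        (C 2 * X 0 * (1 - X 0)) *
          pderiv 0 (C 2 * (1 - X 3 * (X 0 + X 1 ^ 2)) - X 2 * X 3 * X 1 * X 0 * (1 - X 0))) =
      (2 * (1 - 2 * v 0)) * (2 * (1 - v 3 * (v 0 + v 1 ^ 2)) - v 2 * v 3 * v 1 * v 0 * (1 - v 0)) -
        (2 * v 0 * (1 - v 0)) * (-(2 * v 3) - v 2 * v 3 * v 1 * (1 - 2 * v 0)) := by
  simp [Derivation.leibniz, Derivation.leibniz_pow, smul_eq_mul, -mul_eq_mul_left_iff, -mul_eq_mul_right_iff]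
  try ring

/-- Value of the derivative numerator `∂₂A₁·D₁ − A₁·∂₂D₁`. [folklore] -/
theorem evalN1 (v : Fin (2 + 1 + 1) → ℝ) :
    aeval v (pderiv 2 ((-(C 2 * X 2 * (X 3 * X 0 * (1 - X 0) + (1 - C 2 * X 0) * (1 - X 3 * (X 0 + X 1 ^ 2))))) :
            MvPolynomial (Fin (2 + 1 + 1)) ℚ) *
          ((1 - X 3 * (X 0 + X 1 ^ 2)) * (C 2 * (1 - X 3 * (X 0 + X 1 ^ 2)) - X 2 * X 3 * X 1 * X 0 * (1 - X 0))) -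
        (-(C 2 * X 2 * (X 3 * X 0 * (1 - X 0) + (1 - C 2 * X 0) * (1 - X 3 * (X 0 + X 1 ^ 2))))) *
          pderiv 2 ((1 - X 3 * (X 0 + X 1 ^ 2)) *
            (C 2 * (1 - X 3 * (X 0 + X 1 ^ 2)) - X 2 * X 3 * X 1 * X 0 * (1 - X 0)))) =
      (-(2 * (v 3 * v 0 * (1 - v 0) + (1 - 2 * v 0) * (1 - v 3 * (v 0 + v 1 ^ 2))))) *
          ((1 - v 3 * (v 0 + v 1 ^ 2)) * (2 * (1 - v 3 * (v 0 + v 1 ^ 2)) - v 2 * v 3 * v 1 * v 0 * (1 - v 0))) -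
        (-(2 * v 2 * (v 3 * v 0 * (1 - v 0) + (1 - 2 * v 0) * (1 - v 3 * (v 0 + v 1 ^ 2))))) *
          ((1 - v 3 * (v 0 + v 1 ^ 2)) * (-(v 3 * v 1 * v 0 * (1 - v 0)))) := by
  simp [Derivation.leibniz, Derivation.leibniz_pow, smul_eq_mul, -mul_eq_mul_left_iff, -mul_eq_mul_right_iff]
  try ring

/-- Value of the family numerator `P = (1 − 2z₁)Q₁ + ϖz₁(1−z₁)` (expanded). [folklore] -/
theorem evalP (v : Fin (2 + 1) → ℝ) :
    aeval v ((1 - X 2 * X 1 ^ 2 - C 2 * X 0 + C 2 * X 2 * X 0 * X 1 ^ 2 + X 2 * X 0 ^ 2) :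
        MvPolynomial (Fin (2 + 1)) ℚ) =
      1 - v 2 * v 1 ^ 2 - 2 * v 0 + 2 * v 2 * v 0 * v 1 ^ 2 + v 2 * v 0 ^ 2 := by
  simp

/-- Value of the family denominator `Q = Q₁·(Q₁ ∘ g)`. [folklore] -/
theorem evalQ (v : Fin (2 + 1) → ℝ) :
    aeval v ((((1 - X 2 * (X 0 + X 1 ^ 2)) *
        (1 - X 2 * (X 0 + X 0 * (1 - X 0) * X 1 * C (1 / 2 : ℚ) + X 1 ^ 2)))) : MvPolynomial (Fin (2 + 1)) ℚ) =
      (1 - v 2 * (v 0 + v 1 ^ 2)) * (1 - v 2 * (v 0 + v 0 * (1 - v 0) * v 1 * 2⁻¹ + v 1 ^ 2)) := by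
  simp

/-! ### Positivity of the denominators on the closed cube for `0 < ϖ₀ < 1/2` -/

/-- `Q₁ = 1 − p(a + b²) ≥ 1 − 2p > 0` on the closed square. [folklore] -/
theorem Q1_pos {a b p : ℝ} (h0 : 0 < p) (h1 : 2 * p < 1) (ha : 0 ≤ a ∧ a ≤ 1) (hb : 0 ≤ b ∧ b ≤ 1) :
    0 < 1 - p * (a + b ^ 2) := by
  have hb2 : b ^ 2 ≤ 1 := by nlinarith
  nlinarith [mul_le_mul_of_nonneg_left (show a + b ^ 2 ≤ 2 by linarith) h0.le]

/-- `D₀ = 2Q₁ − c·p·b·a(1−a) ≥ 2 − 4p > 0` on the closed cube. [folklore] -/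
theorem D_pos {a b c p : ℝ} (h0 : 0 < p) (h1 : 2 * p < 1) (ha : 0 ≤ a ∧ a ≤ 1) (hb : 0 ≤ b ∧ b ≤ 1)
    (hc : 0 ≤ c ∧ c ≤ 1) : 0 < 2 * (1 - p * (a + b ^ 2)) - c * p * b * a * (1 - a) := by
  have t0 : 0 ≤ a * (1 - a) := mul_nonneg ha.1 (sub_nonneg.2 ha.2)
  have cb1 : c * b ≤ 1 := mul_le_one₀ hc.2 hb.1 hb.2
  have h5 : c * b * (a * (1 - a)) ≤ a * (1 - a) := mul_le_of_le_one_left t0 cb1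
  have hb2 : b ^ 2 ≤ 1 := by nlinarith
  have h6 : 0 ≤ (1 - a) * (2 - a) := mul_nonneg (sub_nonneg.2 ha.2) (by linarith)
  have hS : 2 * (a + b ^ 2) + c * b * (a * (1 - a)) ≤ 4 := by nlinarith
  have h7 : p * (2 * (a + b ^ 2) + c * b * (a * (1 - a))) ≤ p * 4 := mul_le_mul_of_nonneg_left hS h0.le
  nlinarith

/-- `Q₁ ∘ g = 1 − p(a + a(1−a)b/2 + b²) = D₀|_{c=1}/2 > 0` on the closed square. [folklore] -/
theorem Qg_pos {a b p : ℝ} (h0 : 0 < p) (h1 : 2 * p < 1) (ha : 0 ≤ a ∧ a ≤ 1) (hb : 0 ≤ b ∧ b ≤ 1) :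
    0 < 1 - p * (a + a * (1 - a) * b * 2⁻¹ + b ^ 2) := by
  have h := D_pos (c := 1) h0 h1 ha hb ⟨zero_le_one, le_rfl⟩
  have e : 1 - p * (a + a * (1 - a) * b * 2⁻¹ + b ^ 2) =
      (2 * (1 - p * (a + b ^ 2)) - 1 * p * b * a * (1 - a)) / 2 := by
    ring
  rw [e]
  exact div_pos h two_pos

/-! ### The certificate identity (`a = w₀`, `b = w₁`, `c = s`, `p = ϖ₀`) -/

/-- The pointwise identity `F = relA₀(K) + relA_s(M)` behind the certificate: the derivative parts
cancel (`∂₀K + ∂_sM = 0`), the `w₀`-faces of `K` and the `s = 0` face of `M` vanish, and the `s = 1`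
face of `−M` is `(ϖA + A′Q₁)/(Q₁·(Q₁ ∘ g)) = P/Q`. [cite: KontsevichZagier2001, §1.2 rule (3)]
[cite: Ayoub2014, Def. 10] -/
theorem cert (a b c p : ℝ) (hQ1 : 1 - p * (a + b ^ 2) ≠ 0)
    (hQg : 1 - p * (a + a * (1 - a) * b * 2⁻¹ + b ^ 2) ≠ 0)
    (hD : 2 * (1 - p * (a + b ^ 2)) - c * p * b * a * (1 - a) ≠ 0)
    (hD1 : 2 * (1 - p * (a + b ^ 2)) - 1 * p * b * a * (1 - a) ≠ 0) :
    (1 - p * b ^ 2 - 2 * a + 2 * p * a * b ^ 2 + p * a ^ 2) /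
        ((1 - p * (a + b ^ 2)) * (1 - p * (a + a * (1 - a) * b * 2⁻¹ + b ^ 2))) =
      ((2 * (1 - 2 * a)) * (2 * (1 - p * (a + b ^ 2)) - c * p * b * a * (1 - a)) -
            (2 * a * (1 - a)) * (-(2 * p) - c * p * b * (1 - 2 * a))) /
          (2 * (1 - p * (a + b ^ 2)) - c * p * b * a * (1 - a)) ^ 2 -
        2 * 1 * (1 - 1) / (2 * (1 - p * (1 + b ^ 2)) - c * p * b * 1 * (1 - 1)) +
        2 * 0 * (1 - 0) / (2 * (1 - p * (0 + b ^ 2)) - c * p * b * 0 * (1 - 0)) +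
      (((-(2 * (p * a * (1 - a) + (1 - 2 * a) * (1 - p * (a + b ^ 2))))) *
            ((1 - p * (a + b ^ 2)) * (2 * (1 - p * (a + b ^ 2)) - c * p * b * a * (1 - a))) -
          (-(2 * c * (p * a * (1 - a) + (1 - 2 * a) * (1 - p * (a + b ^ 2))))) *
            ((1 - p * (a + b ^ 2)) * (-(p * b * a * (1 - a))))) /
          ((1 - p * (a + b ^ 2)) * (2 * (1 - p * (a + b ^ 2)) - c * p * b * a * (1 - a))) ^ 2 -
        (-(2 * 1 * (p * a * (1 - a) + (1 - 2 * a) * (1 - p * (a + b ^ 2))))) /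
          ((1 - p * (a + b ^ 2)) * (2 * (1 - p * (a + b ^ 2)) - 1 * p * b * a * (1 - a))) +
        (-(2 * 0 * (p * a * (1 - a) + (1 - 2 * a) * (1 - p * (a + b ^ 2))))) /
          ((1 - p * (a + b ^ 2)) * (2 * (1 - p * (a + b ^ 2)) - 0 * p * b * a * (1 - a)))) := by
  have hDsq : (2 * (1 - p * (a + b ^ 2)) - c * p * b * a * (1 - a)) ^ 2 ≠ 0 := pow_ne_zero 2 hD
  have hD1sq : ((1 - p * (a + b ^ 2)) * (2 * (1 - p * (a + b ^ 2)) - c * p * b * a * (1 - a))) ^ 2 ≠ 0 :=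
    pow_ne_zero 2 (mul_ne_zero hQ1 hD)
  have e1 : ((2 * (1 - 2 * a)) * (2 * (1 - p * (a + b ^ 2)) - c * p * b * a * (1 - a)) -
            (2 * a * (1 - a)) * (-(2 * p) - c * p * b * (1 - 2 * a))) /
          (2 * (1 - p * (a + b ^ 2)) - c * p * b * a * (1 - a)) ^ 2 +
      ((-(2 * (p * a * (1 - a) + (1 - 2 * a) * (1 - p * (a + b ^ 2))))) *
            ((1 - p * (a + b ^ 2)) * (2 * (1 - p * (a + b ^ 2)) - c * p * b * a * (1 - a))) -
          (-(2 * c * (p * a * (1 - a) + (1 - 2 * a) * (1 - p * (a + b ^ 2))))) *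
            ((1 - p * (a + b ^ 2)) * (-(p * b * a * (1 - a))))) /
          ((1 - p * (a + b ^ 2)) * (2 * (1 - p * (a + b ^ 2)) - c * p * b * a * (1 - a))) ^ 2 = 0 := by
    rw [div_add_div _ _ hDsq hD1sq, div_eq_zero_iff]
    left
    ring
  have e4 : (-(2 * 1 * (p * a * (1 - a) + (1 - 2 * a) * (1 - p * (a + b ^ 2))))) /
        ((1 - p * (a + b ^ 2)) * (2 * (1 - p * (a + b ^ 2)) - 1 * p * b * a * (1 - a))) +
      (1 - p * b ^ 2 - 2 * a + 2 * p * a * b ^ 2 + p * a ^ 2) /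
        ((1 - p * (a + b ^ 2)) * (1 - p * (a + a * (1 - a) * b * 2⁻¹ + b ^ 2))) = 0 := by
    rw [div_add_div _ _ (mul_ne_zero hQ1 hD1) (mul_ne_zero hQ1 hQg), div_eq_zero_iff]
    left
    ring
  linear_combination e4 - e1

end Loop

open Loop in
/-- STUB `stub_loopInstance` of line `Sketch` — **the fibrewise-loop family's tame fibres are relations.**
For real-algebraic `ϖ₀` with `0 < ϖ₀ < 1/2`, every tame cube representation of the fibre at `ϖ₀` of
`F = ((1 − 2z₁)Q₁ + ϖz₁(1−z₁)) / (Q₁·(Q₁ ∘ g))`, `Q₁ = 1 − ϖ(z₁ + z₂²)`,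
`g = (z₁ + z₁(1−z₁)z₂/2, z₂)`, on `[0,1]²` lies in `KZ.relations`: the two-term `m = 1` rational
`relA` certificate along the interpolated denominator `D_s = (1−s)Q₁ + s·(Q₁ ∘ g)` (`Loop.cert`) fed
to `rational_certificate`. [cite: KontsevichZagier2001, §1.2 rule (3)] [cite: Ayoub2014, Def. 10] -/
theorem stub_loopInstance :
    ∀ (ϖ₀ : ℝ), IsAlgebraic ℚ ϖ₀ → 0 < ϖ₀ → 2 * ϖ₀ < 1 →
      ∀ Φ : KZ.IntegralRep 2, Φ.IsTameCube →
        (∀ z ∈ KZ.cube 2, Φ.integrand z =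
          aeval (Fin.snoc z ϖ₀ : Fin (2 + 1) → ℝ)
              ((1 - X 2 * X 1 ^ 2 - C 2 * X 0 + C 2 * X 2 * X 0 * X 1 ^ 2 + X 2 * X 0 ^ 2) :
                MvPolynomial (Fin (2 + 1)) ℚ) /
            aeval (Fin.snoc z ϖ₀ : Fin (2 + 1) → ℝ)
              (((1 - X 2 * (X 0 + X 1 ^ 2)) *
                (1 - X 2 * (X 0 + X 0 * (1 - X 0) * X 1 * C (1 / 2 : ℚ) + X 1 ^ 2))) :
                MvPolynomial (Fin (2 + 1)) ℚ)) →
        KZ.of Φ ∈ KZ.relations := by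
  intro ϖ₀ halg h0 h1 Φ hΦ hΦi
  refine rational_certificate (n := 2) (m := 1) (K := 2) _ _
    ![(C 2 * X 0 * (1 - X 0)),
      (-(C 2 * X 2 * (X 3 * X 0 * (1 - X 0) + (1 - C 2 * X 0) * (1 - X 3 * (X 0 + X 1 ^ 2)))))]
    ![(C 2 * (1 - X 3 * (X 0 + X 1 ^ 2)) - X 2 * X 3 * X 1 * X 0 * (1 - X 0)),
      ((1 - X 3 * (X 0 + X 1 ^ 2)) * (C 2 * (1 - X 3 * (X 0 + X 1 ^ 2)) - X 2 * X 3 * X 1 * X 0 * (1 - X 0)))]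
    ![0, 2] halg (fun z hz => ?_) (fun k w hw => ?_) (fun w hw => ?_) Φ hΦ hΦi
  · -- `Q(z, ϖ₀) ≠ 0` on the closed square
    rw [evalQ, Gap.snoc3_0, Gap.snoc3_1, Gap.snoc3_2]
    exact mul_ne_zero (Q1_pos h0 h1 (KZ.mem_cube.1 hz 0) (KZ.mem_cube.1 hz 1)).ne'
      (Qg_pos h0 h1 (KZ.mem_cube.1 hz 0) (KZ.mem_cube.1 hz 1)).ne'
  · -- the two denominators do not vanish on the closed cube
    have ha := KZ.mem_cube.1 hw 0
    have hb := KZ.mem_cube.1 hw 1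
    have hc := KZ.mem_cube.1 hw 2
    have hQ1 := Q1_pos h0 h1 ha hb
    have hD := D_pos h0 h1 ha hb hc
    fin_cases k
    · show aeval (Fin.snoc w ϖ₀ : Fin (2 + 1 + 1) → ℝ)
        ((C 2 * (1 - X 3 * (X 0 + X 1 ^ 2)) - X 2 * X 3 * X 1 * X 0 * (1 - X 0)) :
          MvPolynomial (Fin (2 + 1 + 1)) ℚ) ≠ 0
      rw [evalD0, Gap.snoc4_0, Gap.snoc4_1, Gap.snoc4_2, Gap.snoc4_3]
      exact hD.ne'
    · show aeval (Fin.snoc w ϖ₀ : Fin (2 + 1 + 1) → ℝ)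
        (((1 - X 3 * (X 0 + X 1 ^ 2)) * (C 2 * (1 - X 3 * (X 0 + X 1 ^ 2)) - X 2 * X 3 * X 1 * X 0 * (1 - X 0))) :
          MvPolynomial (Fin (2 + 1 + 1)) ℚ) ≠ 0
      rw [evalD1, Gap.snoc4_0, Gap.snoc4_1, Gap.snoc4_2, Gap.snoc4_3]
      exact mul_ne_zero hQ1.ne' hD.ne'
  · -- the pointwise identity on `[0,1]³`
    have ha := KZ.mem_cube.1 hw 0
    have hb := KZ.mem_cube.1 hw 1
    have hc := KZ.mem_cube.1 hw 2
    have hQ1 := (Q1_pos h0 h1 ha hb).ne'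
    have hQg := (Qg_pos h0 h1 ha hb).ne'
    have hD := (D_pos h0 h1 ha hb hc).ne'
    have hD1 := (D_pos (c := 1) h0 h1 ha hb ⟨zero_le_one, le_rfl⟩).ne'
    have hc2 : (Fin.castSucc (2 : Fin (2 + 1)) : Fin (2 + 1 + 1)) = 2 := rfl
    have hca0 : (Fin.castAdd 1 (0 : Fin 2) : Fin (2 + 1)) = 0 := rfl
    have hca1 : (Fin.castAdd 1 (1 : Fin 2) : Fin (2 + 1)) = 1 := rfl
    simp only [Fin.sum_univ_two, Matrix.cons_val_zero, Matrix.cons_val_one, Fin.castSucc_zero, hc2]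
    simp only [map_pow, evalN0, evalN1, evalA0, evalA1, evalD0, evalD1, evalP, evalQ]
    simp only [Gap.snoc4_0, Gap.snoc4_1, Gap.snoc4_2, Gap.snoc4_3, Gap.snoc3_0, Gap.snoc3_1,
      Gap.snoc3_2, hca0, hca1]
    have hu00 : Function.update w 0 (1 : ℝ) 0 = 1 := Function.update_self ..
    have hu01 : Function.update w 0 (1 : ℝ) 1 = w 1 := Function.update_of_ne (by decide) ..
    have hu02 : Function.update w 0 (1 : ℝ) 2 = w 2 := Function.update_of_ne (by decide) ..
    have hz00 : Function.update w 0 (0 : ℝ) 0 = 0 := Function.update_self ..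
    have hz01 : Function.update w 0 (0 : ℝ) 1 = w 1 := Function.update_of_ne (by decide) ..
    have hz02 : Function.update w 0 (0 : ℝ) 2 = w 2 := Function.update_of_ne (by decide) ..
    have hu20 : Function.update w 2 (1 : ℝ) 0 = w 0 := Function.update_of_ne (by decide) ..
    have hu21 : Function.update w 2 (1 : ℝ) 1 = w 1 := Function.update_of_ne (by decide) ..
    have hu22 : Function.update w 2 (1 : ℝ) 2 = 1 := Function.update_self ..
    have hz20 : Function.update w 2 (0 : ℝ) 0 = w 0 := Function.update_of_ne (by decide) ..
    have hz21 : Function.update w 2 (0 : ℝ) 1 = w 1 := Function.update_of_ne (by decide) ..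
    have hz22 : Function.update w 2 (0 : ℝ) 2 = 0 := Function.update_self ..
    simp only [hu00, hu01, hu02, hz00, hz01, hz02, hu20, hu21, hu22, hz20, hz21, hz22]
    linear_combination cert (w 0) (w 1) (w 2) ϖ₀ hQ1 hQg hD hD1

end Summit.KontsevichZagierPeriods.InverseLandau.TateFamilyKernel.Descent
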